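import Summits.HodgeConjecture.HodgeConjecture.Theorems.HLiu418S1BettiSliceExclusion
import Literature.NumberTheory.Automorphic.UnitaryCurveCohCotangentFormsContinuous
import Summits.HodgeConjecture.HodgeConjecture.Theorems.HLiu418IntertwiningLineOfLetters
import Literature.NumberTheory.Automorphic.UnitaryCurveCotangentSpectralProjectionHerm   -- ed. 2: the (D₂) letters APPLIED at hermitian `σ_{w(ι₁)}J⋆` (R1 (α-lite), road (i′))
import Summits.HodgeConjecture.HodgeConjecture.Theorems.HLiu418CurveHodgeTypesDisjoint   -- ed. 2: `isHermitian_map_of_formCongr`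
import HarnessLib

/-!
# Crux `HLiu418`, line `F0_AlbCm` ∕ sub-sub-line `F0_AlbCmS1Betti` — the LINE STUBS (L10) `S1HolLineShape` and (L01) `S1AntiholLineShape` FOLDED
# onto the engine letters E1₂ ∕ E1′₂ ∕ D₂ ∕ E₂ («at most one (1,0)- resp. (0,1)-line through `ω⋆_lab`»; the `n = 2` twins of ★ `F0P3StubS3Fold` ∕ `F0P3StubS4Fold`)

Floor-0 programme P5 (Alb-CM), seat F0P5-p03 (g0) (B2 seat 2, the `n = 2` slice of `stub_S1_betti : S1BettiShape`); crux item stmt-HodgeConjecture-24832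
(`HCCMUnconditional.HLiu418`); sub-sub-line `Cruxes/HLiu418/Lines/F0_AlbCmS1Betti.lean` (F0P5-p01 (g0); stubs `stub_L10 : S1HolLineShape`,
`stub_L01 : S1AntiholLineShape`, `stub_X : S1ExclusionShape`; waist `s1MultOneForms_of_split`; head `stub_S1_betti_holds : S1BettiShape`).
HC_CM is proved only modulo the 7 printed citations until rung 0 closes; this file is `sorry`-free and takes the printed-citation letters as HYPOTHESES.

INPUTS, all ★ and BY NAME: E1₂ `Rogawski1990.curveMultiplicityLeOne` (multiplicity `≤ 1` of the discrete spectrum of `U(J⋆)`, [Rogawski1990, §11] +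
[Har93] as used in [Liu2021, proof of Prop. D.4]; ⇒ distinct discrete `P` are ORTHOGONAL, ★ `isOrtho_space_of_ne`), E1′₂ `curveCohFinComponentUnique_hol ∕
_antihol` (at most one `(1,0)`- resp. `(0,1)`-type discrete `P` with finite component `σ`), D₂ `UnitaryCurveForms.holCotFormSpectralProjection₂ ∕ antihol…`
(TP⁺: the projection onto `P` of the class of a cone-(anti)holomorphic cotangent form is the class of one), E₂ `UnitaryCurveForms.cohIsotypicLine₂_hol ∕
_antihol` (ed. 2, p794463: for `σ` irreducible smooth and `P` discrete, the equivariant `σ → (U(J)(𝔸) → ℂ)` valued in (anti)holomorphic forms CONTAINED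
IN `P` lie on one line); (C₂) continuity of holomorphic curve cotangent forms on `U(J)(𝔸_{L⁺})` = ★ `UnitaryCurveForms.continuous_of_mem_holCotForms₂` (F0P5-p02, p795467) BY NAME.  Tree ∕ this seat: the adjectives of `ω⋆_lab`
(★ `subsingleton_or_isIrreducible_omegaStarGS`, ★ `isSmoothRep_omegaStarGS`), anisotropy of `J⋆` (`S1BettiSliceExclusion.anisotropic_of_formCongr_posDef`)
⇒ compact quotient, automorphic measure, discrete decomposability (★ `AdelicUnitaryGroupSpectrum`), the scalar junction J1″₂
(`ScalarSpectralJunction.hasFinComponent_of_not_orthogonal`), ★ `toLp_toQuotFun_ne_zero`, ★ `F0P3HilbertProjection.exists_irreducible_not_orthogonal`.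

PROOF (generic core `IntertwiningLineOfLetters.exists_intertwiningLine_of_letters`, then the two instantiations).  If `ω⋆_lab = 0` every intertwiner out of it is `0` (`ψ₀ := 0`).
Else `ω⋆_lab` is irreducible and smooth; if no non-zero `A`-valued intertwiner exists, `ψ₀ := 0`; else pick `ψ₁ ≠ 0`: the class of `ψ₁ w₁ ≠ 0` is
`≠ 0` (continuous representative), meets an irreducible closed `P₀` (discrete decomposability), which by TP⁺ is of type `A` and by J1″₂ has finite component
`ω⋆_lab`.  CLAIM: every `A`-valued intertwiner `ψ` has all its classes IN `P₀` — a discrete `P` meeting a class of `ψ w` is of type `A` with finite component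
`ω⋆_lab` (TP⁺ + J1″₂), hence `= P₀` (E1′₂), and «all projections but THE `P₀` vanish ⇒ the class lies in `P₀`» (`mem_space_of_forall_detected_eq`, from E1₂'s
orthogonality).  So E₂ at `P₀` applies to every such `ψ`: `ψ = r • φ₀`, `ψ₁ = r₁ • φ₀` with `r₁ ≠ 0`, whence `ψ = (r r₁⁻¹) • ψ₁` — the line is `ℂ ψ₁`.

ED. 2 (F0P5-p03 (g2), desk ruling R1 (α-lite) ∕ road (i′) 2026-08-31T02:30:56Z; statements byte-identical, proof-only): the two applications of the
letters (D₂)⁺ ∕ (D₂)⁻ go through ★ `UnitaryCurveForms.holCotFormSpectralProjection₂.apply_herm` ∕ `antiholCotFormSpectralProjection₂.apply_herm`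
(★ `UnitaryCurveCotangentSpectralProjectionHerm`), fed the hermitian witness `σ_{w(ι₁)}J⋆` hermitian from `(ι₁ t).im = 0` (★
`CurveHodgeTypesDisjoint.isHermitian_map_of_formCongr`) — so that the letters can be sharpened in place to hermitian `σ_{w(ι)}H` (their honest domain)
with this file re-elaborating unchanged.

References: [Liu2021] Camb. J. Math. 9 (2021), Prop. D.4 (1) and proof p. 130–131, §D.2–§D.3; [Rogawski1990] Ann. of Math. Stud. 123, §11 (Prop. 11.1.1,
11.2.1, Thm. 11.5.1); [BorelJacquet1979] §4.6; [Dixmier1977] §5.4, §13.1; [BorelWallach2000] VII 2.10, 3.2, 3.6; [Borel1997] §5.14.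
-/

set_option autoImplicit false
-- the mandated namespace repeats `HodgeConjecture.HodgeConjecture`, as in every `Theorems/*.lean` of this sub-problem
set_option linter.dupNamespace false

noncomputable section

namespace Summit.HodgeConjecture.HodgeConjecture.Cruxes.HLiu418.S1BettiSliceLines

open scoped TensorProduct Matrix NumberField Kronecker ComplexOrder InnerProductSpace ENNReal
open MeasureTheory
open NumberField NumberField.InfinitePlace IsDedekindDomain
open Summit.HodgeConjecture.CorCM.Model Summit.HodgeConjecture.CorCM.Model.HComp Summit.HodgeConjecture.CorCM.HComp
open Literature.AlgebraicGeometry.Motives (CMType AbelianVariety)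
open Literature.AlgebraicGeometry.ShimuraVarieties Literature.AlgebraicGeometry.ShimuraVarieties.UnitaryCanonicalModel
open Literature.NumberTheory.Automorphic Literature.NumberTheory.Automorphic.UnitaryGroup Literature.NumberTheory.Automorphic.UnitaryCurveForms
open Literature.NumberTheory.Automorphic.UnitaryGroup.CotangentForms (toQuotFun toQuotFun_mk)
open Literature.NumberTheory.Automorphic.IdeleClassGroup Literature.NumberTheory.Automorphic.Liu2021 Literature.NumberTheory.Automorphic.Liu2021.AppendixC
open Literature.NumberTheory.GaloisRepresentations Literature.RepresentationTheory.Liu2021 Literature.RepresentationTheory.HarrisKudlaSweet1996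
open Literature.AlgebraicGeometry.Liu2021 (IsAdmissibleElement)
open Literature.NumberTheory.Weil1964 Literature.NumberTheory.GelbartRogawski1991 Literature.NumberTheory.GelbartRogawski1991.UnitaryDualPair Literature.NumberTheory.GelbartRogawski1991.UnitaryDualPair.WeilCoinv
open Literature.NumberTheory.GelbartRogawski1991.UnitaryDualPair.LocalSplitting
open Literature.NumberTheory.Automorphic.Liu2021.Def411WeilCarriersDoubling
open Literature.NumberTheory.Automorphic.Liu2021.Def411WeilCarriers (TW JW JW_eq isSymm_TW isUnit_det_TW Rep Eps epsOf Chi rhoVAtLine rhoAtLine omegaAtLine)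
open Summit.HodgeConjecture.CorCM (CMField)
open Summit.HodgeConjecture.CorCM.Lines.A3Liu418
open Summit.HodgeConjecture.HodgeConjecture.Cruxes.H413.F0P3HilbertProjection
open Summit.HodgeConjecture.HodgeConjecture.Cruxes.H413.SpectrumJunction
open Summit.HodgeConjecture.HodgeConjecture.Cruxes.HLiu418.ScalarSpectralJunction
open Summit.HodgeConjecture.HodgeConjecture.Cruxes.HLiu418.IntertwiningLineOfLetters
open Summit.HodgeConjecture.HodgeConjecture.Cruxes.HLiu418

/-! ## The two folds at the slice's binders (generic core: ★ `Theorems/HLiu418IntertwiningLineOfLetters`) -/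

set_option synthInstance.maxHeartbeats 400000 in
set_option maxHeartbeats 4000000 in
/-- **THE (L10) FOLD — `S1HolLineShape` from the letters E1₂ (`curveMultiplicityLeOne`), E1′₂ (`curveCohFinComponentUnique_hol`), D₂ (`holCotFormSpectralProjection₂`),
E₂ (`cohIsotypicLine₂_hol`, ed. 2) BY NAME and ★ continuity.**  Its ONLY hypotheses are the four ★ letters.  Conclusion = the TYPE of the
sub-sub-line's `stub_L10 : S1HolLineShape` (binder prefix of `S1MultOneFormsShape` with `h4`) TOKEN FOR TOKEN.  The `n = 2` twin of ★
`F0P3StubS3Fold.stubS3_of_letters`.  HC_CM is proved only modulo the 7 printed citations until rung 0 closes.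
[cite: Liu2021, Prop. D.4 (1) and proof (p. 130–131)] [cite: Rogawski1990, §11.1 Prop. 11.1.1; Prop. 11.2.1; Thm. 11.5.1] [cite: BorelJacquet1979, §4.6]
[cite: Dixmier1977, §5.4] [cite: BorelWallach2000, VII 3.2 and 3.6] -/
theorem stub_L10_of_letters (hE1 : Literature.NumberTheory.Rogawski1990.curveMultiplicityLeOne)
    (hE1' : Literature.NumberTheory.Rogawski1990.curveCohFinComponentUnique_hol)
    (hTP : Literature.NumberTheory.Automorphic.UnitaryCurveForms.holCotFormSpectralProjection₂)
    (hE : Literature.NumberTheory.Automorphic.UnitaryCurveForms.cohIsotypicLine₂_hol)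
    :
      ∀ (F : CMField) [IsGalois ℚ F] (ι₁ : F →+* ℂ)
        (μ : Literature.NumberTheory.Automorphic.IdeleClassGroup (F : Type) →ₜ* Circle)
        (hμ : IdeleClassGroup.IsConjugateSymplectic (F : Type) μ)
        (_hw : IdeleClassGroup.HasWeight (F : Type) μ 1)
        (Jstar : Matrix (Fin 2) (Fin 2) (F : Type)) (t : (F : Type)) (ht : t ≠ 0) (_hτt : 0 < (ι₁ t).re) (_hτt' : (ι₁ t).im = 0)
        (gstar : GL (Fin 2) (F : Type))
        (dJ : Fin 2 → (F : Type)) (hdJ : ∀ i, IsCMField.complexConj (F : Type) (dJ i) = dJ i) (hdJ0 : ∀ i, dJ i ≠ 0)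
        (hg : formCongr ((IsCMField.complexConj (F : Type) : (F : Type) ≃ₐ[↥(maximalRealSubfield (F : Type))] (F : Type)) :
            (F : Type) →+* (F : Type)) gstar (t • Jstar) = Matrix.diagonal dJ)
        (_hsig : (∃ Tstar : GL (Fin 2) ℂ,
            formCongr (starRingEnd ℂ) Tstar ((Matrix.diagonal dJ).map ι₁) = Matrix.diagonal ![(1 : ℂ), -1]) ∧
          ∀ τ' : (F : Type) →+* ℂ, InfinitePlace.mk τ' ≠ InfinitePlace.mk ι₁ → ((Matrix.diagonal dJ).map τ').PosDef)
        (h4 : 4 ≤ Module.finrank ℚ (F : Type))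
        (r : Rep ↥(maximalRealSubfield (F : Type)) (imagUnitSq F))
        (ε : Eps ↥(maximalRealSubfield (F : Type)) (imagUnitSq F))
        (_hadm : ∃ e : (F : Type), IsAdmissibleElement (F : Type) hμ.cmType.1 e ∧
          epsOf ↥(maximalRealSubfield (F : Type)) (imagUnitSq F) (F : Type) (2 * imagUnit (F : Type))⁻¹ (-e) = ε)
        (χ : Chi ↥(maximalRealSubfield (F : Type)) (F : Type) (IsCMField.complexConj (F : Type)))
        (𝔣 : ConeFrame (F : Type) Jstar (cmPlace (F : Type) ι₁)),
        ∃ ψ₀ : Representation.IntertwiningMap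
            ((rhoVAtLine ↥(maximalRealSubfield (F : Type)) (F : Type) (IsCMField.complexConj (F : Type)) 2
              (finProdFinEquiv : Fin 2 × Fin 1 ≃ Fin (2 * 1)) (Matrix.diagonal dJ)
              (complexConj_imagUnit F) (imagUnit_ne_zero F) (imagUnit_mul_self F) (realDiagonal_isSymm F dJ hdJ)
              (isUnit_det_realDiagonal F dJ hdJ hdJ0) (realDiagonal_map F dJ hdJ).symm
              (hsChiGS F finProdFinEquiv dJ hdJ hdJ0
                (toHeckeCharacter (F : Type) (galConj (IsCMField.complexConj (F : Type)) μ))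
                (isUnitary_toHeckeCharacter (F : Type) (galConj (IsCMField.complexConj (F : Type)) μ))
                ((isOscillatorChar_toHeckeCharacter_iff (galConj (IsCMField.complexConj (F : Type)) μ)).mpr hμ.galConj))
              (r.toFun ε) χ).comp
              (finAdelicCongr ↥(maximalRealSubfield (F : Type)) (F : Type) (IsCMField.complexConj (F : Type)) gstar ht hg).symm.toMonoidHom)
            (rightRep₂ ↥(maximalRealSubfield (F : Type)) (F : Type) (IsCMField.complexConj (F : Type)) Jstar),
          ∀ ψ : Representation.IntertwiningMap
            ((rhoVAtLine ↥(maximalRealSubfield (F : Type)) (F : Type) (IsCMField.complexConj (F : Type)) 2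
              (finProdFinEquiv : Fin 2 × Fin 1 ≃ Fin (2 * 1)) (Matrix.diagonal dJ)
              (complexConj_imagUnit F) (imagUnit_ne_zero F) (imagUnit_mul_self F) (realDiagonal_isSymm F dJ hdJ)
              (isUnit_det_realDiagonal F dJ hdJ hdJ0) (realDiagonal_map F dJ hdJ).symm
              (hsChiGS F finProdFinEquiv dJ hdJ hdJ0
                (toHeckeCharacter (F : Type) (galConj (IsCMField.complexConj (F : Type)) μ))
                (isUnitary_toHeckeCharacter (F : Type) (galConj (IsCMField.complexConj (F : Type)) μ))
                ((isOscillatorChar_toHeckeCharacter_iff (galConj (IsCMField.complexConj (F : Type)) μ)).mpr hμ.galConj))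
              (r.toFun ε) χ).comp
              (finAdelicCongr ↥(maximalRealSubfield (F : Type)) (F : Type) (IsCMField.complexConj (F : Type)) gstar ht hg).symm.toMonoidHom)
            (rightRep₂ ↥(maximalRealSubfield (F : Type)) (F : Type) (IsCMField.complexConj (F : Type)) Jstar),
          (∀ w, ψ w ∈ holCotForms₂ ↥(maximalRealSubfield (F : Type)) (F : Type) (IsCMField.complexConj (F : Type)) Jstar
              (IsCMField.complexConj_ne_one (F : Type)) (UnitaryGroup.complexConj_smul_infinitePlace (F : Type))
              (cmPlace (F : Type) ι₁) 𝔣) → ∃ a : ℂ, ψ = a • ψ₀ := by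
  intro F _ ι₁ μ hμ hw Jstar t ht hτt hτt' gstar dJ hdJ hdJ0 hg hsig h4 r ε hadm χ 𝔣
  -- `J⋆` anisotropic ⇒ an automorphic measure with COMPACT quotient and discretely decomposable `L²`; E1₂ ⇒ multiplicity one
  obtain ⟨τ, hτ⟩ := UnitaryGroup.exists_infinitePlace_ne (F : Type) h4 ι₁
  have hanis := S1BettiSliceExclusion.anisotropic_of_formCongr_posDef (F : Type) Jstar t gstar dJ hg τ (hsig.2 τ hτ)
  obtain ⟨μA, hμA, hdisc⟩ :=
    UnitaryGroup.exists_isAutomorphicMeasure_isDiscretelyDecomposable_adelicGroupData (F : Type) 2 Jstar hanis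
  haveI := hμA
  haveI : CompactSpace (adelicGroupData ↥(maximalRealSubfield (F : Type)) (F : Type) (IsCMField.complexConj (F : Type)) 2 Jstar).automorphicQuotient :=
    UnitaryGroup.compactSpace_cmDatum_automorphicQuotient (F : Type) 2 Jstar hanis
  have h1 : ((adelicGroupData ↥(maximalRealSubfield (F : Type)) (F : Type) (IsCMField.complexConj (F : Type)) 2 Jstar).rightRegular μA).HasMultiplicityOne :=
    (ContRepresentation.hasMultiplicityOne_iff_multiplicity_le_one_holds
        ((adelicGroupData ↥(maximalRealSubfield (F : Type)) (F : Type) (IsCMField.complexConj (F : Type)) 2 Jstar).isUnitary_rightRegular μA)).mpr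
      fun W hW => hE1 (F : Type) ι₁ Jstar dJ hdJ hdJ0 t ht gstar hg hsig.1 hsig.2 h4 μA ⟨W, hW⟩
  -- `ω⋆_lab` is ZERO or IRREDUCIBLE (★); smooth (★)
  have hsmR := isSmoothRep_omegaStarGS F dJ hdJ hdJ0
    (toHeckeCharacter (F : Type) (galConj (IsCMField.complexConj (F : Type)) μ))
    (isUnitary_toHeckeCharacter (F : Type) (galConj (IsCMField.complexConj (F : Type)) μ))
    ((isOscillatorChar_toHeckeCharacter_iff (galConj (IsCMField.complexConj (F : Type)) μ)).mpr hμ.galConj)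
    (r.toFun ε) χ ht gstar hg
  have hsm : Representation.IsSmooth
      ((rhoVAtLine ↥(maximalRealSubfield (F : Type)) (F : Type) (IsCMField.complexConj (F : Type)) 2
          (finProdFinEquiv : Fin 2 × Fin 1 ≃ Fin (2 * 1)) (Matrix.diagonal dJ)
          (complexConj_imagUnit F) (imagUnit_ne_zero F) (imagUnit_mul_self F) (realDiagonal_isSymm F dJ hdJ)
          (isUnit_det_realDiagonal F dJ hdJ hdJ0) (realDiagonal_map F dJ hdJ).symm
          (hsChiGS F finProdFinEquiv dJ hdJ hdJ0
            (toHeckeCharacter (F : Type) (galConj (IsCMField.complexConj (F : Type)) μ))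
            (isUnitary_toHeckeCharacter (F : Type) (galConj (IsCMField.complexConj (F : Type)) μ))
            ((isOscillatorChar_toHeckeCharacter_iff (galConj (IsCMField.complexConj (F : Type)) μ)).mpr hμ.galConj))
          (r.toFun ε) χ).comp
          (finAdelicCongr ↥(maximalRealSubfield (F : Type)) (F : Type) (IsCMField.complexConj (F : Type)) gstar ht hg).symm.toMonoidHom) :=
    fun v => by
      obtain ⟨S, hS, hfixv⟩ := hsmR v
      exact Representation.isSmoothVector_of_le _ hS fun k hk => hfixv k hk
  rcases subsingleton_or_isIrreducible_omegaStarGS F dJ hdJ hdJ0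
    (toHeckeCharacter (F : Type) (galConj (IsCMField.complexConj (F : Type)) μ))
    (isUnitary_toHeckeCharacter (F : Type) (galConj (IsCMField.complexConj (F : Type)) μ))
    ((isOscillatorChar_toHeckeCharacter_iff (galConj (IsCMField.complexConj (F : Type)) μ)).mpr hμ.galConj)
    (r.toFun ε) χ ht gstar hg with hsub | hirr
  · -- the zero carrier: every intertwiner out of it vanishes
    refine ⟨0, fun ψ _ => ⟨0, ?_⟩⟩
    rw [zero_smul]
    apply Representation.IntertwiningMap.ext
    apply LinearMap.ext
    intro w
    rw [Subsingleton.elim w 0, map_zero, map_zero]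
  -- continuity at this frame
  have hcontA : ∀ f ∈ (holCotForms₂ ↥(maximalRealSubfield (F : Type)) (F : Type) (IsCMField.complexConj (F : Type)) Jstar
      (IsCMField.complexConj_ne_one (F : Type)) (UnitaryGroup.complexConj_smul_infinitePlace (F : Type)) (cmPlace (F : Type) ι₁) 𝔣), Continuous f := fun f hf => continuous_of_mem_holCotForms₂ _ _ _ _ _ _ _ 𝔣 hf
  exact exists_intertwiningLine_of_letters (μ := μA) hdisc h1 _ hirr
    (holCotForms₂ ↥(maximalRealSubfield (F : Type)) (F : Type) (IsCMField.complexConj (F : Type)) Jstar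
      (IsCMField.complexConj_ne_one (F : Type)) (UnitaryGroup.complexConj_smul_infinitePlace (F : Type)) (cmPlace (F : Type) ι₁) 𝔣)
    (fun f hf => S1BettiSliceExclusion.leftInvariant_of_mem_holCotForms₂ hf) (fun f hf => hcontA f hf)
    (fun P => P.IsHolCotangentAt₂ (IsCMField.complexConj_ne_one (F : Type)) (UnitaryGroup.complexConj_smul_infinitePlace (F : Type))
      (cmPlace (F : Type) ι₁) 𝔣)
    (fun P f hf hfL hu => by
      -- ed. 2: the letter applied AT HERMITIAN `σ_{w(ι₁)}J⋆` (★ `….apply_herm`), witness from `(ι₁ t).im = 0`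
      obtain ⟨f', hf', hf'L, heq⟩ := hTP.apply_herm (F : Type) ι₁ Jstar dJ hdJ hdJ0 t ht gstar hg
        (CurveHodgeTypesDisjoint.isHermitian_map_of_formCongr (F : Type) ι₁ Jstar t ht hτt' gstar dJ hdJ hg _) hsig.1 hsig.2 h4 𝔣 μA P f hf hfL
      have hne : MemLp.toLp (toQuotFun _ f') hf'L ≠ 0 := by
        rw [← heq, Submodule.starProjection_apply]
        exact Subtype.coe_ne_coe.mpr (orthogonalProjectionOnto_ne_zero P.space hu)
      refine ⟨f', hf', ?_, hf'L, ?_⟩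
      · rintro rfl
        exact hne (MemLp.toLp_zero hf'L)
      · rw [← heq]
        exact Submodule.starProjection_apply_mem _ _)
    (fun P P' hP hP' hf hf' => hE1' (F : Type) ι₁ Jstar dJ hdJ hdJ0 t ht gstar hg hsig.1 hsig.2 h4 𝔣 μA _ _ hirr hsm P P' hP hP' hf hf')
    (fun P => hE (F : Type) ι₁ Jstar dJ hdJ hdJ0 t ht gstar hg hsig.1 hsig.2 h4 𝔣 μA _ _ hirr hsm P)

set_option synthInstance.maxHeartbeats 400000 in
set_option maxHeartbeats 4000000 in
/-- **THE (L01) FOLD — `S1AntiholLineShape` from E1₂, E1′₂ (`curveCohFinComponentUnique_antihol`), D₂ (`antiholCotFormSpectralProjection₂`),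
E₂ (`cohIsotypicLine₂_antihol`, ed. 2) BY NAME** (antiholomorphic forms are continuous as conjugates of holomorphic ones, ★).
Conclusion = the TYPE of `stub_L01 : S1AntiholLineShape` TOKEN FOR TOKEN; the `n = 2` twin of ★ `F0P3StubS4Fold`.  HC_CM is proved only modulo
the 7 printed citations until rung 0 closes. [cite: Liu2021, Prop. D.4 (1) and proof (p. 130–131)] [cite: Rogawski1990, §11.1 Prop. 11.1.1; Prop. 11.2.1; Thm. 11.5.1] [cite: BorelJacquet1979, §4.6] [cite: Dixmier1977, §5.4] [cite: BorelWallach2000, VII 2.10, 3.2 and 3.6] -/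
theorem stub_L01_of_letters (hE1 : Literature.NumberTheory.Rogawski1990.curveMultiplicityLeOne)
    (hE1' : Literature.NumberTheory.Rogawski1990.curveCohFinComponentUnique_antihol)
    (hTP : Literature.NumberTheory.Automorphic.UnitaryCurveForms.antiholCotFormSpectralProjection₂)
    (hE : Literature.NumberTheory.Automorphic.UnitaryCurveForms.cohIsotypicLine₂_antihol)
    :
      ∀ (F : CMField) [IsGalois ℚ F] (ι₁ : F →+* ℂ)
        (μ : Literature.NumberTheory.Automorphic.IdeleClassGroup (F : Type) →ₜ* Circle)
        (hμ : IdeleClassGroup.IsConjugateSymplectic (F : Type) μ)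
        (_hw : IdeleClassGroup.HasWeight (F : Type) μ 1)
        (Jstar : Matrix (Fin 2) (Fin 2) (F : Type)) (t : (F : Type)) (ht : t ≠ 0) (_hτt : 0 < (ι₁ t).re) (_hτt' : (ι₁ t).im = 0)
        (gstar : GL (Fin 2) (F : Type))
        (dJ : Fin 2 → (F : Type)) (hdJ : ∀ i, IsCMField.complexConj (F : Type) (dJ i) = dJ i) (hdJ0 : ∀ i, dJ i ≠ 0)
        (hg : formCongr ((IsCMField.complexConj (F : Type) : (F : Type) ≃ₐ[↥(maximalRealSubfield (F : Type))] (F : Type)) :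
            (F : Type) →+* (F : Type)) gstar (t • Jstar) = Matrix.diagonal dJ)
        (_hsig : (∃ Tstar : GL (Fin 2) ℂ,
            formCongr (starRingEnd ℂ) Tstar ((Matrix.diagonal dJ).map ι₁) = Matrix.diagonal ![(1 : ℂ), -1]) ∧
          ∀ τ' : (F : Type) →+* ℂ, InfinitePlace.mk τ' ≠ InfinitePlace.mk ι₁ → ((Matrix.diagonal dJ).map τ').PosDef)
        (h4 : 4 ≤ Module.finrank ℚ (F : Type))
        (r : Rep ↥(maximalRealSubfield (F : Type)) (imagUnitSq F))
        (ε : Eps ↥(maximalRealSubfield (F : Type)) (imagUnitSq F))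
        (_hadm : ∃ e : (F : Type), IsAdmissibleElement (F : Type) hμ.cmType.1 e ∧
          epsOf ↥(maximalRealSubfield (F : Type)) (imagUnitSq F) (F : Type) (2 * imagUnit (F : Type))⁻¹ (-e) = ε)
        (χ : Chi ↥(maximalRealSubfield (F : Type)) (F : Type) (IsCMField.complexConj (F : Type)))
        (𝔣 : ConeFrame (F : Type) Jstar (cmPlace (F : Type) ι₁)),
        ∃ ψ₀ : Representation.IntertwiningMap
            ((rhoVAtLine ↥(maximalRealSubfield (F : Type)) (F : Type) (IsCMField.complexConj (F : Type)) 2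
              (finProdFinEquiv : Fin 2 × Fin 1 ≃ Fin (2 * 1)) (Matrix.diagonal dJ)
              (complexConj_imagUnit F) (imagUnit_ne_zero F) (imagUnit_mul_self F) (realDiagonal_isSymm F dJ hdJ)
              (isUnit_det_realDiagonal F dJ hdJ hdJ0) (realDiagonal_map F dJ hdJ).symm
              (hsChiGS F finProdFinEquiv dJ hdJ hdJ0
                (toHeckeCharacter (F : Type) (galConj (IsCMField.complexConj (F : Type)) μ))
                (isUnitary_toHeckeCharacter (F : Type) (galConj (IsCMField.complexConj (F : Type)) μ))
                ((isOscillatorChar_toHeckeCharacter_iff (galConj (IsCMField.complexConj (F : Type)) μ)).mpr hμ.galConj))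
              (r.toFun ε) χ).comp
              (finAdelicCongr ↥(maximalRealSubfield (F : Type)) (F : Type) (IsCMField.complexConj (F : Type)) gstar ht hg).symm.toMonoidHom)
            (rightRep₂ ↥(maximalRealSubfield (F : Type)) (F : Type) (IsCMField.complexConj (F : Type)) Jstar),
          ∀ ψ : Representation.IntertwiningMap
            ((rhoVAtLine ↥(maximalRealSubfield (F : Type)) (F : Type) (IsCMField.complexConj (F : Type)) 2
              (finProdFinEquiv : Fin 2 × Fin 1 ≃ Fin (2 * 1)) (Matrix.diagonal dJ)
              (complexConj_imagUnit F) (imagUnit_ne_zero F) (imagUnit_mul_self F) (realDiagonal_isSymm F dJ hdJ)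
              (isUnit_det_realDiagonal F dJ hdJ hdJ0) (realDiagonal_map F dJ hdJ).symm
              (hsChiGS F finProdFinEquiv dJ hdJ hdJ0
                (toHeckeCharacter (F : Type) (galConj (IsCMField.complexConj (F : Type)) μ))
                (isUnitary_toHeckeCharacter (F : Type) (galConj (IsCMField.complexConj (F : Type)) μ))
                ((isOscillatorChar_toHeckeCharacter_iff (galConj (IsCMField.complexConj (F : Type)) μ)).mpr hμ.galConj))
              (r.toFun ε) χ).comp
              (finAdelicCongr ↥(maximalRealSubfield (F : Type)) (F : Type) (IsCMField.complexConj (F : Type)) gstar ht hg).symm.toMonoidHom)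
            (rightRep₂ ↥(maximalRealSubfield (F : Type)) (F : Type) (IsCMField.complexConj (F : Type)) Jstar),
          (∀ w, ψ w ∈ (holCotForms₂ ↥(maximalRealSubfield (F : Type)) (F : Type) (IsCMField.complexConj (F : Type)) Jstar
              (IsCMField.complexConj_ne_one (F : Type)) (UnitaryGroup.complexConj_smul_infinitePlace (F : Type))
              (cmPlace (F : Type) ι₁) 𝔣).map (conjFun₂ ↥(maximalRealSubfield (F : Type)) (F : Type) (IsCMField.complexConj (F : Type)) Jstar)) → ∃ a : ℂ, ψ = a • ψ₀ := by
  intro F _ ι₁ μ hμ hw Jstar t ht hτt hτt' gstar dJ hdJ hdJ0 hg hsig h4 r ε hadm χ 𝔣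
  -- `J⋆` anisotropic ⇒ an automorphic measure with COMPACT quotient and discretely decomposable `L²`; E1₂ ⇒ multiplicity one
  obtain ⟨τ, hτ⟩ := UnitaryGroup.exists_infinitePlace_ne (F : Type) h4 ι₁
  have hanis := S1BettiSliceExclusion.anisotropic_of_formCongr_posDef (F : Type) Jstar t gstar dJ hg τ (hsig.2 τ hτ)
  obtain ⟨μA, hμA, hdisc⟩ :=
    UnitaryGroup.exists_isAutomorphicMeasure_isDiscretelyDecomposable_adelicGroupData (F : Type) 2 Jstar hanis
  haveI := hμA
  haveI : CompactSpace (adelicGroupData ↥(maximalRealSubfield (F : Type)) (F : Type) (IsCMField.complexConj (F : Type)) 2 Jstar).automorphicQuotient :=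
    UnitaryGroup.compactSpace_cmDatum_automorphicQuotient (F : Type) 2 Jstar hanis
  have h1 : ((adelicGroupData ↥(maximalRealSubfield (F : Type)) (F : Type) (IsCMField.complexConj (F : Type)) 2 Jstar).rightRegular μA).HasMultiplicityOne :=
    (ContRepresentation.hasMultiplicityOne_iff_multiplicity_le_one_holds
        ((adelicGroupData ↥(maximalRealSubfield (F : Type)) (F : Type) (IsCMField.complexConj (F : Type)) 2 Jstar).isUnitary_rightRegular μA)).mpr
      fun W hW => hE1 (F : Type) ι₁ Jstar dJ hdJ hdJ0 t ht gstar hg hsig.1 hsig.2 h4 μA ⟨W, hW⟩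
  -- `ω⋆_lab` is ZERO or IRREDUCIBLE (★); smooth (★)
  have hsmR := isSmoothRep_omegaStarGS F dJ hdJ hdJ0
    (toHeckeCharacter (F : Type) (galConj (IsCMField.complexConj (F : Type)) μ))
    (isUnitary_toHeckeCharacter (F : Type) (galConj (IsCMField.complexConj (F : Type)) μ))
    ((isOscillatorChar_toHeckeCharacter_iff (galConj (IsCMField.complexConj (F : Type)) μ)).mpr hμ.galConj)
    (r.toFun ε) χ ht gstar hg
  have hsm : Representation.IsSmooth
      ((rhoVAtLine ↥(maximalRealSubfield (F : Type)) (F : Type) (IsCMField.complexConj (F : Type)) 2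
          (finProdFinEquiv : Fin 2 × Fin 1 ≃ Fin (2 * 1)) (Matrix.diagonal dJ)
          (complexConj_imagUnit F) (imagUnit_ne_zero F) (imagUnit_mul_self F) (realDiagonal_isSymm F dJ hdJ)
          (isUnit_det_realDiagonal F dJ hdJ hdJ0) (realDiagonal_map F dJ hdJ).symm
          (hsChiGS F finProdFinEquiv dJ hdJ hdJ0
            (toHeckeCharacter (F : Type) (galConj (IsCMField.complexConj (F : Type)) μ))
            (isUnitary_toHeckeCharacter (F : Type) (galConj (IsCMField.complexConj (F : Type)) μ))
            ((isOscillatorChar_toHeckeCharacter_iff (galConj (IsCMField.complexConj (F : Type)) μ)).mpr hμ.galConj))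
          (r.toFun ε) χ).comp
          (finAdelicCongr ↥(maximalRealSubfield (F : Type)) (F : Type) (IsCMField.complexConj (F : Type)) gstar ht hg).symm.toMonoidHom) :=
    fun v => by
      obtain ⟨S, hS, hfixv⟩ := hsmR v
      exact Representation.isSmoothVector_of_le _ hS fun k hk => hfixv k hk
  rcases subsingleton_or_isIrreducible_omegaStarGS F dJ hdJ hdJ0
    (toHeckeCharacter (F : Type) (galConj (IsCMField.complexConj (F : Type)) μ))
    (isUnitary_toHeckeCharacter (F : Type) (galConj (IsCMField.complexConj (F : Type)) μ))
    ((isOscillatorChar_toHeckeCharacter_iff (galConj (IsCMField.complexConj (F : Type)) μ)).mpr hμ.galConj)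
    (r.toFun ε) χ ht gstar hg with hsub | hirr
  · -- the zero carrier: every intertwiner out of it vanishes
    refine ⟨0, fun ψ _ => ⟨0, ?_⟩⟩
    rw [zero_smul]
    apply Representation.IntertwiningMap.ext
    apply LinearMap.ext
    intro w
    rw [Subsingleton.elim w 0, map_zero, map_zero]
  -- continuity at this frame
  have hcontA : ∀ f ∈ (holCotForms₂ ↥(maximalRealSubfield (F : Type)) (F : Type) (IsCMField.complexConj (F : Type)) Jstar
      (IsCMField.complexConj_ne_one (F : Type)) (UnitaryGroup.complexConj_smul_infinitePlace (F : Type)) (cmPlace (F : Type) ι₁) 𝔣), Continuous f := fun f hf => continuous_of_mem_holCotForms₂ _ _ _ _ _ _ _ 𝔣 hf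
  exact exists_intertwiningLine_of_letters (μ := μA) hdisc h1 _ hirr
    ((holCotForms₂ ↥(maximalRealSubfield (F : Type)) (F : Type) (IsCMField.complexConj (F : Type)) Jstar
      (IsCMField.complexConj_ne_one (F : Type)) (UnitaryGroup.complexConj_smul_infinitePlace (F : Type)) (cmPlace (F : Type) ι₁) 𝔣).map
      (conjFun₂ ↥(maximalRealSubfield (F : Type)) (F : Type) (IsCMField.complexConj (F : Type)) Jstar))
    (fun f hf => S1BettiSliceExclusion.leftInvariant_of_mem_map_conjFun₂ hf) (fun f hf => continuous_of_mem_map_conjFun₂ _ _ _ _ _ _ _ 𝔣 hf)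
    (fun P => P.IsAntiholCotangentAt₂ (IsCMField.complexConj_ne_one (F : Type)) (UnitaryGroup.complexConj_smul_infinitePlace (F : Type))
      (cmPlace (F : Type) ι₁) 𝔣)
    (fun P f hf hfL hu => by
      -- ed. 2: the letter applied AT HERMITIAN `σ_{w(ι₁)}J⋆` (★ `….apply_herm`), witness from `(ι₁ t).im = 0`
      obtain ⟨f', hf', hf'L, heq⟩ := hTP.apply_herm (F : Type) ι₁ Jstar dJ hdJ hdJ0 t ht gstar hg
        (CurveHodgeTypesDisjoint.isHermitian_map_of_formCongr (F : Type) ι₁ Jstar t ht hτt' gstar dJ hdJ hg _) hsig.1 hsig.2 h4 𝔣 μA P f hf hfL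
      have hne : MemLp.toLp (toQuotFun _ f') hf'L ≠ 0 := by
        rw [← heq, Submodule.starProjection_apply]
        exact Subtype.coe_ne_coe.mpr (orthogonalProjectionOnto_ne_zero P.space hu)
      refine ⟨f', hf', ?_, hf'L, ?_⟩
      · rintro rfl
        exact hne (MemLp.toLp_zero hf'L)
      · rw [← heq]
        exact Submodule.starProjection_apply_mem _ _)
    (fun P P' hP hP' hf hf' => hE1' (F : Type) ι₁ Jstar dJ hdJ hdJ0 t ht gstar hg hsig.1 hsig.2 h4 𝔣 μA _ _ hirr hsm P P' hP hP' hf hf')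
    (fun P => hE (F : Type) ι₁ Jstar dJ hdJ hdJ0 t ht gstar hg hsig.1 hsig.2 h4 𝔣 μA _ _ hirr hsm P)

end Summit.HodgeConjecture.HodgeConjecture.Cruxes.HLiu418.S1BettiSliceLines

end
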